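import Summits.NavierStokesRegularity.NavierStokesRegularity.Theorems.SqueezeCycleSingularZoom
import Summits.NavierStokesRegularity.NavierStokesRegularity.Theses.LerayQuarterDissipation
import HarnessLib

/-!
# Route `LerayQuarterDissipation`, support item `DissipativeZoom`
# (stmt-NavierStokesRegularity-22146): the singular Type-I zoom limit inherits the global
# quarter-rate dissipation law

`--workitem stmt-NavierStokesRegularity-22146`. The item: at a backward-singular final-time point
`(T, x₀)` of a classical Leray–Hopf solution `(u, p)` on `ℝ³ × [0, T)` (viscosity `ν > 0`) from a
rapidly decaying datum, with the velocity Type-I rate `IsTypeIBlowup u T` and the quarter-rate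
enstrophy law `∫ |curl u(t)|² ≤ K/√(T − t)` on `[0, T)`, some KNSS / Albritton–Barker zoom limit
`ū` is a Type-I ancient mild field in the KNSS gauge (`IsTypeIAncientMild C ū`), obeys the GLOBAL
dissipation law `∫_{ℝ³} ‖∇ū(s)‖² ≤ K'/√(−s)` for every `s < 0`, and is unbounded on every backward
cylinder at the space–time origin.

Proof. We re-run the tree's singular Type-I zoom (`singularZoom_zoomLimit`,
`Theorems/SqueezeCycleSingularZoom.lean`: the viscosity-normalising zooms
`w_c = (cα) • u ∘ Φ_c`, `Φ_c(s, y) = (T + c²β s, x₀ + cR y)`, `α = R/ν`, `β = R²/ν`, along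
`c_k = 1/(k+4)`, their `C¹_loc` extraction `exists_tendsto_of_typeI_seq_Ioo` and the apex
singularity `zoomSeq_unbounded_at_origin`) and add one estimate: by the chain rule, the
substitution `x = x₀ + cR y`, `‖Dv‖_op ≤ |Dv|_F`, `∫ |Dv|²_F ≤ ∫ |curl v|²` for divergence-free
`L²` fields (`lintegral_frobeniusNormSq_fderiv_le_lintegral_sq_norm_curl`) and the quarter law,
`∫ ‖∇w_c(s)‖² = c α² R⁻¹ ∫ ‖∇u(T + c²βs)‖² ≤ (α² K⁺/(R√β)) / √(−s)` — the factor `c` cancels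
(scale invariance of the quarter law) — and Fatou's lemma under the pointwise convergence of the
gradients passes the bound to the limit (`zoom_dissipation_le`, `dissipativeZoom_zoomLimit`).
Main result: `lerayQuarterDissipation_dissipativeZoom_proof : LerayQuarterDissipation.DissipativeZoom`.

HONEST FRAMING: a compactness / bookkeeping statement about a HYPOTHESISED blow-up obeying a
HYPOTHESISED enstrophy law; nothing here proves the quarter law, excludes the profile, or says
anything about Navier–Stokes regularity. References: Koch–Nadirashvili–Seregin–Šverák, Acta Math.
203 (2009), §6; Albritton–Barker, Arch. Ration. Mech. Anal. 232 (2019), §3; Seregin–Šverák 2009,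
§3; Leray 1934, §20 (scaling).
-/

noncomputable section

open MeasureTheory Set Function Filter TopologicalSpace Metric
open scoped Topology NNReal ENNReal

namespace Summit.NavierStokesRegularity.NavierStokesRegularity.Theorems

-- the problem directory repeats the summit name (`NavierStokesRegularity/NavierStokesRegularity`)
set_option linter.dupNamespace false

open Literature.Analysis Literature.Analysis.FluidPDE

namespace DissipativeZoom

/-- **Gradient against vorticity in `L²`**: for a `C²` divergence-free `L²` field `v` on `ℝ³`,
`∫ ‖Dv‖²_op ≤ ∫ |curl v|²` (`‖Dv‖_op ≤ |Dv|_F` pointwise and `∫ |Dv|²_F ≤ ∫ |curl v|²`, the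
tree's `lintegral_frobeniusNormSq_fderiv_le_lintegral_sq_norm_curl`). [folklore] -/
theorem lintegral_fderiv_sq_le_curl {v : EuclideanSpace ℝ (Fin 3) → EuclideanSpace ℝ (Fin 3)}
    (hv : ContDiff ℝ 2 v) (hdiv : VectorCalculus.IsDivFree v) (hv2 : MemLp v 2 volume) :
    ∫⁻ x, ‖fderiv ℝ v x‖ₑ ^ 2 ≤ ∫⁻ x, ‖curl v x‖ₑ ^ 2 := by
  have hL2 : ∫⁻ x, ‖v x‖ₑ ^ 2 < ⊤ := by
    have h := lintegral_rpow_enorm_lt_top_of_eLpNorm_lt_top two_ne_zero ENNReal.ofNat_ne_top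
      hv2.eLpNorm_lt_top
    simpa [ENNReal.toReal_ofNat] using h
  calc ∫⁻ x, ‖fderiv ℝ v x‖ₑ ^ 2 ≤ ∫⁻ x, ENNReal.ofReal (frobeniusNormSq (fderiv ℝ v x)) := by
        refine lintegral_mono fun x => ?_
        rw [show ‖fderiv ℝ v x‖ₑ ^ 2 = ENNReal.ofReal (‖fderiv ℝ v x‖ ^ 2) by
          rw [← ofReal_norm, ENNReal.ofReal_pow (norm_nonneg _)]]
        exact ENNReal.ofReal_le_ofReal (sq_opNorm_le_frobeniusNormSq _)
    _ ≤ ∫⁻ x, ‖curl v x‖ₑ ^ 2 := lintegral_frobeniusNormSq_fderiv_le_lintegral_sq_norm_curl hv hdiv hL2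

/-- **The gradient of a rescaled slice**: for `w = a • stPull β γ t₀ x₀ u` and a differentiable
slice `u(t₀ + βs)`, `∇(w s)(y) = (aγ) ∇u(t₀ + βs)(x₀ + γ y)` (chain rule). [folklore] -/
theorem fderiv_smul_stPull {a β γ t₀ : ℝ} (x₀ : EuclideanSpace ℝ (Fin 3))
    (u : ℝ → EuclideanSpace ℝ (Fin 3) → EuclideanSpace ℝ (Fin 3)) {s : ℝ}
    (hd : Differentiable ℝ (u (t₀ + β * s))) (y : EuclideanSpace ℝ (Fin 3)) :
    fderiv ℝ ((a • stPull β γ t₀ x₀ u) s) y = (a * γ) • fderiv ℝ (u (t₀ + β * s)) (x₀ + γ • y) := by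
  have hd' : Differentiable ℝ (stPull β γ t₀ x₀ u s) := differentiable_stPull_slice hd
  rw [show (a • stPull β γ t₀ x₀ u) s = fun z => a • stPull β γ t₀ x₀ u s z from rfl,
    fderiv_fun_const_smul (hd' y), fderiv_stPull, smul_smul]

/-- **Scaling of the dissipation of a rescaled slice**: for `w = a • stPull β γ t₀ x₀ u`, `γ ≠ 0`,
and a differentiable slice `u(t₀ + βs)`,
`∫ ‖∇(w s)‖² = (aγ)² |γ|⁻³ ∫ ‖∇u(t₀ + βs)‖²` (chain rule and the substitution `x = x₀ + γ y`). [folklore] -/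
theorem lintegral_fderiv_smul_stPull_sq {a β γ t₀ : ℝ} (x₀ : EuclideanSpace ℝ (Fin 3))
    (u : ℝ → EuclideanSpace ℝ (Fin 3) → EuclideanSpace ℝ (Fin 3)) {s : ℝ} (hγ : γ ≠ 0)
    (hd : Differentiable ℝ (u (t₀ + β * s))) :
    ∫⁻ y, ‖fderiv ℝ ((a • stPull β γ t₀ x₀ u) s) y‖ₑ ^ 2 =
      ENNReal.ofReal ((a * γ) ^ 2) * (ENNReal.ofReal |(γ ^ 3)⁻¹| *
        ∫⁻ x, ‖fderiv ℝ (u (t₀ + β * s)) x‖ₑ ^ 2) := by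
  set F : EuclideanSpace ℝ (Fin 3) → ℝ≥0∞ := fun x => ‖fderiv ℝ (u (t₀ + β * s)) x‖ₑ ^ 2 with hF
  have hpt : ∀ y, ‖fderiv ℝ ((a • stPull β γ t₀ x₀ u) s) y‖ₑ ^ 2 =
      ENNReal.ofReal ((a * γ) ^ 2) * F (x₀ + γ • y) := by
    intro y
    rw [fderiv_smul_stPull x₀ u hd y, enorm_smul, mul_pow, Real.enorm_eq_ofReal_abs,
      ← ENNReal.ofReal_pow (abs_nonneg _), sq_abs]
  have hsub : ∫⁻ y, F (x₀ + γ • y) = ENNReal.ofReal |(γ ^ 3)⁻¹| * ∫⁻ x, F x := by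
    have h := Literature.Analysis.FluidPDE.lintegral_comp_smul (fun z => F (x₀ + z)) hγ
    simp only [finrank_euclideanSpace_fin] at h
    rw [h, lintegral_add_left_eq_self F x₀]
  calc ∫⁻ y, ‖fderiv ℝ ((a • stPull β γ t₀ x₀ u) s) y‖ₑ ^ 2
      = ∫⁻ y, ENNReal.ofReal ((a * γ) ^ 2) * F (x₀ + γ • y) := lintegral_congr hpt
    _ = ENNReal.ofReal ((a * γ) ^ 2) * ∫⁻ y, F (x₀ + γ • y) :=
        lintegral_const_mul' _ _ ENNReal.ofReal_ne_top
    _ = _ := by rw [hsub]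

end DissipativeZoom

section Zoom

variable {ν T : ℝ} {u : ℝ → EuclideanSpace ℝ (Fin 3) → EuclideanSpace ℝ (Fin 3)}
  {p : ℝ → EuclideanSpace ℝ (Fin 3) → ℝ} {x₀ : EuclideanSpace ℝ (Fin 3)} {δ R α β c : ℝ}

/-- **The dissipation of the zooms under the quarter law** (scale invariance of
`λ ‖∇u(T + λ²s)‖²₂`): for a classical Leray–Hopf solution `(u, p)` on `[0, T)` with
`∫ |curl u(t)|² ≤ K/√(T − t)` on `[0, T)`, scales `0 < R`, `α = R/ν`, `β = R²/ν`, `0 < c`,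
`δ ≤ T`, the zoom `w = (cα) • stPull (c²β) (cR) T x₀ u` satisfies, at every time `s` of its final
window `(−δ/(c²β), 0)`, `∫ ‖∇w(s)‖² ≤ (α² K⁺/(R√β)) / √(−s)` — a bound independent of `c`
(`‖∇·‖²₂ ≤ ‖curl ·‖²₂` for divergence-free `L²` slices, chain rule, substitution). [cite: Leray1934, §20; KochNadirashviliSereginSverak2009, (1.4) (arXiv p. 2)] -/
theorem zoom_dissipation_le (hν : 0 < ν) (hsol : IsClassicalNSSolutionOn (Ico 0 T) ν 0 u p)
    (hLH : IsLerayHopfOn T ν 0 (u 0) u) (hR : 0 < R) (hα : α = R / ν) (hβ : β = R ^ 2 / ν)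
    (hc : 0 < c) (hδT : δ ≤ T) {K : ℝ}
    (hquarter : ∀ t ∈ Ico 0 T,
      ∫⁻ x, ‖curl (u t) x‖ₑ ^ 2 ≤ ENNReal.ofReal (K / Real.sqrt (T - t)))
    {s : ℝ} (hs : s ∈ Ioo (-(δ / (c ^ 2 * β))) 0) :
    ∫⁻ y, ‖fderiv ℝ (((c * α) • stPull (c ^ 2 * β) (c * R) T x₀ u) s) y‖ₑ ^ 2 ≤
      ENNReal.ofReal ((α ^ 2 * max K 0 / (R * Real.sqrt β)) / Real.sqrt (-s)) := by
  have hαpos : 0 < α := by rw [hα]; positivity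
  have hβpos : 0 < β := by rw [hβ]; positivity
  have hcR : c * R ≠ 0 := (mul_pos hc hR).ne'
  obtain ⟨htw, htI⟩ := zoom_time_mem (T := T) hc hβpos hδT hs
  set t : ℝ := T + c ^ 2 * β * s with ht
  -- the slice `u t`: `C²`, divergence free, finite energy
  have hv2 : ContDiff ℝ 2 (u t) := (hsol.contDiff_velocity htI).of_le (by norm_cast)
  have hdu : Differentiable ℝ (u t) := hv2.differentiable (by norm_num)
  have hGC : ∫⁻ x, ‖fderiv ℝ (u t) x‖ₑ ^ 2 ≤ ENNReal.ofReal (max K 0 / Real.sqrt (T - t)) :=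
    (DissipativeZoom.lintegral_fderiv_sq_le_curl hv2 (hsol.divFree t htI)
      (hLH.memLp t ⟨htI.1, htI.2.le⟩)).trans ((hquarter t htI).trans
        (ENNReal.ofReal_le_ofReal (div_le_div_of_nonneg_right (le_max_left _ _)
          (Real.sqrt_nonneg _))))
  -- the scaling identity
  have hdu' : Differentiable ℝ (u (T + c ^ 2 * β * s)) := hdu
  rw [DissipativeZoom.lintegral_fderiv_smul_stPull_sq x₀ u hcR hdu']
  -- `√(T − t) = c √β √(−s)`
  have hTt : T - t = c ^ 2 * β * (-s) := by rw [ht]; ring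
  have hspos : 0 < -s := neg_pos.2 hs.2
  have hsq : Real.sqrt (T - t) = c * Real.sqrt β * Real.sqrt (-s) := by
    rw [hTt, Real.sqrt_mul (by positivity), Real.sqrt_mul (by positivity), Real.sqrt_sq hc.le]
  have hsqβ : 0 < Real.sqrt β := Real.sqrt_pos.2 hβpos
  have hsqs : 0 < Real.sqrt (-s) := Real.sqrt_pos.2 hspos
  have hK0 : 0 ≤ max K 0 := le_max_right _ _
  have habs : |((c * R) ^ 3)⁻¹| = ((c * R) ^ 3)⁻¹ := abs_of_pos (by positivity)
  calc ENNReal.ofReal ((c * α * (c * R)) ^ 2) * (ENNReal.ofReal |((c * R) ^ 3)⁻¹| *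
        ∫⁻ x, ‖fderiv ℝ (u (T + c ^ 2 * β * s)) x‖ₑ ^ 2)
      ≤ ENNReal.ofReal ((c * α * (c * R)) ^ 2) * (ENNReal.ofReal |((c * R) ^ 3)⁻¹| *
          ENNReal.ofReal (max K 0 / Real.sqrt (T - t))) := by gcongr
    _ = ENNReal.ofReal ((c * α * (c * R)) ^ 2 * (((c * R) ^ 3)⁻¹ *
          (max K 0 / Real.sqrt (T - t)))) := by
        rw [habs, ← ENNReal.ofReal_mul (by positivity), ← ENNReal.ofReal_mul (by positivity)]
    _ = ENNReal.ofReal ((α ^ 2 * max K 0 / (R * Real.sqrt β)) / Real.sqrt (-s)) := by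
        congr 1
        rw [hsq]
        field_simp

/-- **Backward singularity at `(T, x₀)` on small cylinders gives it on all cylinders**
(monotonicity of `Q_r(T, x₀)` in `r` and of `eLpNorm` in the measure). [folklore] -/
theorem eLpNorm_top_cylinder_eq_top_of_small (hT : 0 < T)
    (hx₀ : ∀ r : ℝ, 0 < r → r ^ 2 < T →
      eLpNorm (uncurry u) ⊤ (volume.restrict (parabolicCylinder r ((T : ℝ), x₀))) = ⊤)
    {r : ℝ} (hr : 0 < r) :
    eLpNorm (uncurry u) ∞ (volume.restrict (parabolicCylinder r ((T : ℝ), x₀))) = ∞ := by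
  set r' : ℝ := min r (Real.sqrt T / 2) with hr'
  have hr'pos : 0 < r' := lt_min hr (by positivity)
  have hr'r : r' ≤ r := min_le_left _ _
  have hr'T : r' ^ 2 < T := by
    have h1 : r' ≤ Real.sqrt T / 2 := min_le_right _ _
    have h2 : r' ^ 2 ≤ (Real.sqrt T / 2) ^ 2 := pow_le_pow_left₀ hr'pos.le h1 2
    have h3 : (Real.sqrt T / 2) ^ 2 = T / 4 := by
      rw [div_pow, Real.sq_sqrt hT.le]; norm_num
    linarith
  have hsub : parabolicCylinder r' ((T : ℝ), x₀) ⊆ parabolicCylinder r ((T : ℝ), x₀) := by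
    have h2 : r' ^ 2 ≤ r ^ 2 := pow_le_pow_left₀ hr'pos.le hr'r 2
    exact prod_mono (Ioo_subset_Ioo (by linarith) le_rfl) (ball_subset_ball hr'r)
  have hmono : eLpNorm (uncurry u) ∞ (volume.restrict (parabolicCylinder r' ((T : ℝ), x₀))) ≤
      eLpNorm (uncurry u) ∞ (volume.restrict (parabolicCylinder r ((T : ℝ), x₀))) :=
    eLpNorm_mono_measure _ (Measure.restrict_mono hsub le_rfl)
  rw [hx₀ r' hr'pos hr'T] at hmono
  exact top_le_iff.1 hmono

end Zoom

/-- **The dissipative singular Type-I zoom limit.** For `ν > 0`, `T > 0`, a classical solution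
`(u, p)` on `ℝ³ × [0, T)`, Leray–Hopf from a rapidly decaying datum, with `IsTypeIBlowup u T` and
the quarter-rate enstrophy law `∫ |curl u(t)|² ≤ K/√(T − t)` on `[0, T)`, and a point `x₀` at
which `u` is essentially unbounded on every backward cylinder `Q_r(T, x₀)`, `r² < T`: there are
`C`, `K'` and a Type-I KNSS-mild ancient field `ū` (`IsTypeIAncientMild C ū`) with the global
dissipation law `∫ ‖∇ū(s)‖² ≤ K'/√(−s)` for all `s < 0`, unbounded at the origin. The zoom and its
apex singularity are the tree's `singularZoom_zoomLimit` construction (Albritton–Barker 2019 §3,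
KNSS 2009 Lemma 6.1); the law is `zoom_dissipation_le` passed to the limit by Fatou's lemma under
the pointwise convergence of the gradients. [cite: AlbrittonBarker2019, §3 and Prop. 2.3; KochNadirashviliSereginSverak2009, Lemma 6.1 (arXiv p. 11)] -/
theorem dissipativeZoom_zoomLimit : ∀ (ν T : ℝ), 0 < ν → 0 < T →
      ∀ (u : ℝ → EuclideanSpace ℝ (Fin 3) → EuclideanSpace ℝ (Fin 3))
        (p : ℝ → EuclideanSpace ℝ (Fin 3) → ℝ),
        IsClassicalNSSolutionOn (Ico 0 T) ν 0 u p → IsLerayHopfOn T ν 0 (u 0) u →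
        HasRapidSpatialDecay (u 0) → IsTypeIBlowup u T →
        ∀ K : ℝ, (∀ t ∈ Ico 0 T,
          ∫⁻ x, ‖curl (u t) x‖ₑ ^ 2 ≤ ENNReal.ofReal (K / Real.sqrt (T - t))) →
        ∀ x₀ : EuclideanSpace ℝ (Fin 3),
          (∀ r : ℝ, 0 < r → r ^ 2 < T →
            eLpNorm (uncurry u) ⊤ (volume.restrict (parabolicCylinder r ((T : ℝ), x₀))) = ⊤) →
          ∃ (C K' : ℝ) (ū : ℝ → EuclideanSpace ℝ (Fin 3) → EuclideanSpace ℝ (Fin 3)),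
            IsTypeIAncientMild C ū ∧
            (∀ s : ℝ, s < 0 →
              ∫⁻ x, ‖fderiv ℝ (ū s) x‖ₑ ^ 2 ≤ ENNReal.ofReal (K' / Real.sqrt (-s))) ∧
            (∀ r > 0, ∀ M : ℝ, ∃ t ∈ Ioo (-(r ^ 2)) (0 : ℝ),
              ∃ x ∈ ball (0 : EuclideanSpace ℝ (Fin 3)) r, M < ‖ū t x‖) := by
  intro ν T hν hT u p hsol hLH hdec hTI K hK x₀ hx₀
  have hsing : ∀ r : ℝ, 0 < r →
      eLpNorm (uncurry u) ∞ (volume.restrict (parabolicCylinder r ((T : ℝ), x₀))) = ∞ :=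
    fun r hr => eLpNorm_top_cylinder_eq_top_of_small hT hx₀ hr
  -- ## (1) the Type-I rate window, the Morrey bound and the unit zoom at `(T, x₀)`
  obtain ⟨C, δ, -, hδ, hδT, hrate⟩ := exists_typeI_rate_window hT hTI
  obtain ⟨r₀, M₀, T₁, hr₀, hT₁, hMor⟩ := morrey_of_typeI hν hT hsol hLH hTI
  obtain ⟨R, α, β, hR, hα, hβ, hβeq, hαeq, hβT, hball, hGv, htypeI⟩ :=
    exists_zoom_typeIBound_lt_top_of_morrey hν hT hsol hLH hr₀ hT₁ hMor x₀
  set πv : ℝ → EuclideanSpace ℝ (Fin 3) → ℝ :=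
    α ^ 2 • stPull β R T x₀ (fun t x => p t x - (p t 0 - normalisedPressure (u t) 0)) with hπv
  have hI₀top : typeIBound (parabolicCylinder (1 / 2) (0 : ℝ × EuclideanSpace ℝ (Fin 3)))
      (α • stPull β R T x₀ u) πv ((α * R) • stPull β R T x₀ (fun t x => fderiv ℝ (u t) x)) ≠ ⊤ :=
    htypeI.ne
  -- ## (2) the scales `c k = 1/(k+4) ↓ 0` and the zoom sequence
  set c : ℕ → ℝ := fun k => 1 / ((k : ℝ) + 4) with hc
  have hcpos : ∀ k, 0 < c k := fun k => by simp only [hc]; positivity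
  have hc4 : ∀ k, c k ≤ 1 / 4 := fun k =>
    div_le_div_of_nonneg_left zero_le_one (by norm_num) (by linarith [(Nat.cast_nonneg k : (0 : ℝ) ≤ k)])
  have hc2 : ∀ k, c k ≤ 1 / 2 := fun k => (hc4 k).trans (by norm_num)
  set w : ℕ → ℝ → EuclideanSpace ℝ (Fin 3) → EuclideanSpace ℝ (Fin 3) :=
    fun k => (c k * α) • stPull (c k ^ 2 * β) (c k * R) T x₀ u with hw
  -- the final windows `(A k, 0)`, `A k → -∞`
  set A : ℕ → ℝ := fun k => -(δ / (c k ^ 2 * β)) with hA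
  have hAk : ∀ k, A k = -(δ / β * ((k : ℝ) + 4) ^ 2) := by
    intro k
    simp only [hA, hc]
    field_simp
  have hAlim : Tendsto A atTop atBot := by
    have h1 : Tendsto (fun k : ℕ => ((k : ℝ) + 4) ^ 2) atTop atTop :=
      (tendsto_pow_atTop two_ne_zero).comp
        (tendsto_atTop_add_const_right _ _ tendsto_natCast_atTop_atTop)
    have h2 : Tendsto (fun k : ℕ => δ / β * ((k : ℝ) + 4) ^ 2) atTop atTop :=
      h1.const_mul_atTop (by positivity)
    refine (tendsto_neg_atTop_atBot.comp h2).congr fun k => ?_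
    rw [hAk k]
    rfl
  -- ## (3) per-scale facts
  have hcW : ∀ k, ContinuousOn (uncurry (w k)) (Ioo (A k) 0 ×ˢ univ) := fun k =>
    zoom_continuousOn hν hsol hR hαeq hβeq (hcpos k) hδT
  have hdivW : ∀ k, ∀ t ∈ Ioo (A k) 0, IsWeaklyDivFree (w k t) := fun k t ht =>
    zoom_isWeaklyDivFree hν hsol hR hαeq hβeq (hcpos k) hδT ht
  have hmildW : ∀ k, ∀ s t : ℝ, A k < s → s < t → t < 0 → ∀ y,
      w k t y = UnboundedOperators.heatExtension (w k s) (t - s) y -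
        oseenDuhamel 1 s (w k) (w k) t y := fun k s t hs hst ht y =>
    zoom_oseen hν hT hsol hLH hdec hR hαeq hβeq (hcpos k) hδT hs hst ht y
  set C₁ : ℝ := α * C / Real.sqrt β with hC₁
  have hIW : ∀ k, ∀ t ∈ Ioo (A k) 0, ∀ y, ‖w k t y‖ ≤ C₁ / Real.sqrt (-t) := fun k t ht y =>
    zoom_norm_le hR hαeq hβeq hν (hcpos k) hδT hrate ht y
  -- the dissipation of the zooms (NEW): `∫ ‖∇w_k(s)‖² ≤ K'/√(−s)` on the window of `k`
  set K' : ℝ := α ^ 2 * max K 0 / (R * Real.sqrt β) with hK'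
  have hDW : ∀ k, ∀ s ∈ Ioo (A k) 0,
      ∫⁻ y, ‖fderiv ℝ (w k s) y‖ₑ ^ 2 ≤ ENNReal.ofReal (K' / Real.sqrt (-s)) := fun k s hs =>
    zoom_dissipation_le (x₀ := x₀) hν hsol hLH hR hαeq hβeq (hcpos k) hδT hK hs
  -- ## (4) extraction of the `C¹_loc` limit `W`
  obtain ⟨φ, hφ, W, hWclass, hpt, hptG, -, -⟩ :=
    exists_tendsto_of_typeI_seq_Ioo C₁ hAlim hcW hdivW hmildW hIW
  have hφt : Tendsto φ atTop atTop := hφ.tendsto_atTop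
  have hAφ : Tendsto (fun j => A (φ j)) atTop atBot := hAlim.comp hφt
  -- ## (5) the dissipation law of `W` (Fatou under the pointwise convergence of the gradients)
  have hlaw : ∀ s : ℝ, s < 0 →
      ∫⁻ y, ‖fderiv ℝ (W s) y‖ₑ ^ 2 ≤ ENNReal.ofReal (K' / Real.sqrt (-s)) := by
    intro s hs
    have hev : ∀ᶠ j in atTop,
        ∫⁻ y, ‖fderiv ℝ (w (φ j) s) y‖ₑ ^ 2 ≤ ENNReal.ofReal (K' / Real.sqrt (-s)) := by
      filter_upwards [hAφ.eventually (eventually_lt_atBot s)] with j hj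
      exact hDW (φ j) s ⟨hj, hs⟩
    calc ∫⁻ y, ‖fderiv ℝ (W s) y‖ₑ ^ 2
        = ∫⁻ y, liminf (fun j => ‖fderiv ℝ (w (φ j) s) y‖ₑ ^ 2) atTop := by
          refine lintegral_congr fun y => ?_
          exact (((ENNReal.continuous_pow 2).tendsto _).comp (hptG s hs y).enorm).liminf_eq.symm
      _ ≤ liminf (fun j => ∫⁻ y, ‖fderiv ℝ (w (φ j) s) y‖ₑ ^ 2) atTop :=
          lintegral_liminf_le fun j => (measurable_fderiv ℝ (w (φ j) s)).enorm.pow_const _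
      _ ≤ ENNReal.ofReal (K' / Real.sqrt (-s)) := liminf_le_of_frequently_le' hev.frequently
  -- ## (6) `W` is unbounded at the origin
  have hsingW : ∀ r > 0, ∀ M : ℝ, ∃ t ∈ Ioo (-(r ^ 2)) (0 : ℝ),
      ∃ x ∈ ball (0 : EuclideanSpace ℝ (Fin 3)) r, M < ‖W t x‖ :=
    zoomSeq_unbounded_at_origin (πv := πv) hsol hR hα hβ hβT hsing hball hGv hI₀top
      (fun j => hcpos (φ j)) (fun j => hc2 (φ j)) fun z hz =>
        hpt z.1 ((SuitableCompactness.mem_parabolicCylinder_zero.1 hz).1.2) z.2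
  exact ⟨C₁, K', W, hWclass, hlaw, hsingW⟩

/-- **`DissipativeZoom` (item stmt-NavierStokesRegularity-22146, route `LerayQuarterDissipation`)
holds**: the dissipative singular Type-I zoom limit `dissipativeZoom_zoomLimit`. A support
(compactness) step only; it does not prove the quarter law, the finite-dissipation Liouville
statement, or anything about Navier–Stokes regularity. [cite: AlbrittonBarker2019, §3; KochNadirashviliSereginSverak2009, Lemma 6.1] -/
theorem lerayQuarterDissipation_dissipativeZoom_proof :
    Summit.NavierStokesRegularity.NavierStokesRegularity.Theses.LerayQuarterDissipation.DissipativeZoom := by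
  unfold Summit.NavierStokesRegularity.NavierStokesRegularity.Theses.LerayQuarterDissipation.DissipativeZoom
  intro ν T hν hT u p hsol hLH hdec hTI K hK x₀ hx₀
  exact dissipativeZoom_zoomLimit ν T hν hT u p hsol hLH hdec hTI K hK x₀ hx₀

end Summit.NavierStokesRegularity.NavierStokesRegularity.Theorems

end
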